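import Literature.NumberTheory.EllipticCurves.Kato2004.IwasawaTwistTateToTateH1Proofs
import Literature.NumberTheory.EllipticCurves.Kato2004.IwasawaTwistTateExactProofs
import Literature.NumberTheory.GaloisRepresentations.ContinuousCorestrictionComp
import Literature.NumberTheory.EllipticCurves.Kato2004.IwasawaCohomologyExistsProofs
import HarnessLib

/-!
# Kato (2004), §13.8 / §14.14 — the twisted-Tate Shapiro tower, II: naturality of the inverse Shapiro
  map, integrality, bridges to the inverse-limit comparison

Literature layer — PROOFS ONLY, no new definitions, no axioms.  Continuation of
`Kato2004.IwasawaTwistTateToTateH1Proofs` towards the left exactness of Kato's (14.14.1)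
[cite: Kato2004Asterisque, §14.14 (p. 243)], in the finite-coefficient model
`𝕋 = lim_{(n,k)} W[p^k] ⊗ ℤ[Gal(ℚ_n/ℚ)]` (`P_a = W[p^{a₂}] ⊗ ℤ[Gal(ℚ_{a₁}/ℚ)]`, `a ∈ ℕ × ℕ`):

* §6 naturality of `cor_{Γ_{a₁}→Γ_0} ∘ H¹(δ_0) : H¹(Γ_{a₁}, W[p^{a₂}]) → H¹(Γ_0, P_a)` under the
  transition maps `red` (`mapH1AddHom_red_coresLe_single`) — Kato's "inverse limit with respect to the
  trace maps" (§12.2) read through the Shapiro identification of §13.8;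
* §7 integrality: an `integralH1` class is carried to a class of `H¹(Γ_0, P_a)` that dies on
  `Γ_{a₁} ⊓ I_𝔓` for every `𝔓 ∤ p` (`resLe_coresLe_single_eq_zero_of_mem_integralH1`);
* §8 bridges: surjectivity of the transitions (`red_surjective`), finiteness of the coefficients
  (`finite_coeff`), `cohomologyMap (redHom h) 1 = H¹(red h)` and `cohomologyMap (projHom a) 1 = H¹(pr_a)`
  for `systemOn H`, `H¹(red h) ∘ H¹(pr_b) = H¹(pr_a)`, `H¹([p^{k'−k}]) ∘ red_{p^{k'}} = red_{p^k}`.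

References: K. Kato, *p-adic Hodge theory and values of zeta functions of modular forms*, Astérisque 295
(2004), §8.2, §12.2, §13.8, §14.14 [cite: Kato2004Asterisque]; J. Neukirch, A. Schmidt, K. Wingberg,
*Cohomology of Number Fields* (2008), I §5, II §7 [cite: NeukirchSchmidtWingberg2008]; J. H. Silverman,
*The Arithmetic of Elliptic Curves* (2009), III §7 [cite: SilvermanAEC2009].
-/

noncomputable section

open scoped Topology NumberField
open Field Filter CategoryTheory Finset IsDedekindDomain
open Literature.NumberTheory.GaloisRepresentations
open Literature.NumberTheory.EllipticCurves
open WeierstrassCurve (geomPoints geomTorsion)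

namespace Literature.NumberTheory.EllipticCurves.Kato2004

open Literature.NumberTheory.EllipticCurves.Kato2004.EulerSystemValues

namespace TwistTate

variable (W : WeierstrassCurve ℚ) [W.IsElliptic] (p : ℕ) [Fact p.Prime]
  [ContinuousSMul ℤ_[p] (W.tateModule p)] (κ : ZpExtension ℚ p)

/-! ## §6 The inverse Shapiro map `cor ∘ H¹(δ_0)` along the transition maps `red` -/

omit [W.IsElliptic] [ContinuousSMul ℤ_[p] (W.tateModule p)] in
/-- `red ∘ δ_0 = δ_0 ∘ torsionPowReduce`: on a unit vector at the identity coset the transition map of the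
coefficient system only multiplies the coefficient by `p^{k'−k}`. [cite: Kato2004Asterisque, §13.8 (p. 228)] -/
theorem red_comp_single_zero {a b : ℕ × ℕ} (h : a ≤ b) :
    (red W p h).comp (AddMonoidHom.single (fun _ : ZMod (p ^ b.1) => geomTorsion W ((p : ℤ) ^ b.2)) 0) =
      (AddMonoidHom.single (fun _ : ZMod (p ^ a.1) => geomTorsion W ((p : ℤ) ^ a.2)) 0).comp
        (torsionPowReduce W p h.2) := by
  classical
  refine AddMonoidHom.ext fun m => funext fun c => ?_
  change red W p h (Pi.single 0 m) c = (Pi.single 0 (torsionPowReduce W p h.2 m) : Coeff W p a) c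
  rw [red_apply, fiberSum_single h.1 0 m, map_zero]
  by_cases hc : c = 0
  · subst hc; rw [Pi.single_eq_same, Pi.single_eq_same]
  · rw [Pi.single_eq_of_ne hc, Pi.single_eq_of_ne hc, map_zero]

omit [W.IsElliptic] [ContinuousSMul ℤ_[p] (W.tateModule p)] in
/-- `red` is equivariant for every subgroup (hypothesis shape of `mapH1AddHom`). [cite: Kato2004Asterisque, §13.8 (p. 228)] -/
theorem red_subgroupRep {a b : ℕ × ℕ} (h : a ≤ b) (H : Subgroup (absoluteGaloisGroup ℚ)) (u : H)
    (y : Coeff W p b) :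
    red W p h ((subgroupRep ((system W p κ).ρ b).toTopRep H).ρ u y) =
      (subgroupRep ((system W p κ).ρ a).toTopRep H).ρ u (red W p h y) :=
  red_smul W p κ h (u : absoluteGaloisGroup ℚ) y

omit [W.IsElliptic] [Fact (Nat.Prime p)] [ContinuousSMul ℤ_[p] (W.tateModule p)] in
/-- `torsionPowReduce` is equivariant for every subgroup (hypothesis shape of `mapH1AddHom`).
[cite: SilvermanAEC2009, III.§7] -/
theorem torsionPowReduce_subgroupRep {k k' : ℕ} (h : k ≤ k') (H : Subgroup (absoluteGaloisGroup ℚ)) (u : H)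
    (m : geomTorsion W ((p : ℤ) ^ k')) :
    torsionPowReduce W p h ((subgroupRep (W.torsionGaloisModule ((p : ℤ) ^ k')).toTopRep H).ρ u m) =
      (subgroupRep (W.torsionGaloisModule ((p : ℤ) ^ k)).toTopRep H).ρ u (torsionPowReduce W p h m) :=
  torsionPowReduce_smul W p h (u : absoluteGaloisGroup ℚ) m

omit [W.IsElliptic] [ContinuousSMul ℤ_[p] (W.tateModule p)] in
/-- **Naturality of the inverse Shapiro map `cor_{Γ_n→Γ_0} ∘ H¹(δ_0)` under the transition maps**:
for `a ≤ b` in `ℕ × ℕ`, `H¹(red) (cor_{Γ_{b₁}→Γ_0} (H¹(δ_0) x)) = cor_{Γ_{a₁}→Γ_0} (H¹(δ_0) (H¹(p^{b₂−a₂}·)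
(cor_{Γ_{b₁}→Γ_{a₁}} x)))` — FORMAL from the naturality of `cor` in the coefficients
(`mapH1AddHom_coresLe`), its transitivity (`coresLe_comp`) and `red ∘ δ_0 = δ_0 ∘ (p^{b₂−a₂}·)`; this is
Kato's "the inverse limit is taken with respect to trace maps" (§12.2) read through §13.8's Shapiro
identification. [cite: Kato2004Asterisque, §12.2 (p. 220) and §13.8 (p. 228)]
[cite: NeukirchSchmidtWingberg2008, Prop. 1.5.3] -/
theorem mapH1AddHom_red_coresLe_single {a b : ℕ × ℕ} (h : a ≤ b)
    [Fintype (κ.layerSubgroup 0 ⧸ (κ.layerSubgroup b.1).subgroupOf (κ.layerSubgroup 0))]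
    [Fintype (κ.layerSubgroup 0 ⧸ (κ.layerSubgroup a.1).subgroupOf (κ.layerSubgroup 0))]
    [Fintype (κ.layerSubgroup a.1 ⧸ (κ.layerSubgroup b.1).subgroupOf (κ.layerSubgroup a.1))]
    (hcr : Continuous (red W p h)) (hctp : Continuous (torsionPowReduce W p h.2))
    (hcsa : Continuous (AddMonoidHom.single (fun _ : ZMod (p ^ a.1) => geomTorsion W ((p : ℤ) ^ a.2)) 0))
    (hcsb : Continuous (AddMonoidHom.single (fun _ : ZMod (p ^ b.1) => geomTorsion W ((p : ℤ) ^ b.2)) 0))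
    (x : continuousCohomology 1
      (subgroupRep (W.torsionGaloisModule ((p : ℤ) ^ b.2)).toTopRep (κ.layerSubgroup b.1))) :
    mapH1AddHom (subgroupRep ((system W p κ).ρ b).toTopRep (κ.layerSubgroup 0))
        (subgroupRep ((system W p κ).ρ a).toTopRep (κ.layerSubgroup 0)) (red W p h) hcr
        (red_subgroupRep W p κ h (κ.layerSubgroup 0))
        (coresLe ((system W p κ).ρ b).toTopRep (κ.layerSubgroup_antitone (Nat.zero_le b.1))
          (κ.isOpen_layerSubgroup b.1)
          (mapH1AddHom (subgroupRep (W.torsionGaloisModule ((p : ℤ) ^ b.2)).toTopRep (κ.layerSubgroup b.1))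
            (subgroupRep ((system W p κ).ρ b).toTopRep (κ.layerSubgroup b.1))
            (AddMonoidHom.single (fun _ : ZMod (p ^ b.1) => geomTorsion W ((p : ℤ) ^ b.2)) 0) hcsb
            (single_subgroupRep W p κ b le_rfl 0) x)) =
      coresLe ((system W p κ).ρ a).toTopRep (κ.layerSubgroup_antitone (Nat.zero_le a.1))
        (κ.isOpen_layerSubgroup a.1)
        (mapH1AddHom (subgroupRep (W.torsionGaloisModule ((p : ℤ) ^ a.2)).toTopRep (κ.layerSubgroup a.1))
          (subgroupRep ((system W p κ).ρ a).toTopRep (κ.layerSubgroup a.1))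
          (AddMonoidHom.single (fun _ : ZMod (p ^ a.1) => geomTorsion W ((p : ℤ) ^ a.2)) 0) hcsa
          (single_subgroupRep W p κ a le_rfl 0)
          (mapH1AddHom (subgroupRep (W.torsionGaloisModule ((p : ℤ) ^ b.2)).toTopRep (κ.layerSubgroup a.1))
            (subgroupRep (W.torsionGaloisModule ((p : ℤ) ^ a.2)).toTopRep (κ.layerSubgroup a.1))
            (torsionPowReduce W p h.2) hctp (torsionPowReduce_subgroupRep W p h.2 (κ.layerSubgroup a.1))
            (coresLe (W.torsionGaloisModule ((p : ℤ) ^ b.2)).toTopRep (κ.layerSubgroup_antitone h.1)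
              (κ.isOpen_layerSubgroup b.1) x))) := by
  -- notation for the three subgroups and the modules
  have hb0 : κ.layerSubgroup b.1 ≤ κ.layerSubgroup 0 := κ.layerSubgroup_antitone (Nat.zero_le b.1)
  have ha0 : κ.layerSubgroup a.1 ≤ κ.layerSubgroup 0 := κ.layerSubgroup_antitone (Nat.zero_le a.1)
  have hba : κ.layerSubgroup b.1 ≤ κ.layerSubgroup a.1 := κ.layerSubgroup_antitone h.1
  -- (1) `cor` is natural in the coefficients: move `H¹(red)` inside
  refine (mapH1AddHom_coresLe (X := ((system W p κ).ρ b).toTopRep) (Y := ((system W p κ).ρ a).toTopRep)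
    (red W p h) hcr hb0 (κ.isOpen_layerSubgroup b.1)
    (red_subgroupRep W p κ h (κ.layerSubgroup b.1)) (red_subgroupRep W p κ h (κ.layerSubgroup 0)) _).trans ?_
  -- (2) `red ∘ δ_0 = δ_0 ∘ torsionPowReduce` on `H¹(Γ_{b₁}, ·)`
  have h2 : mapH1AddHom (subgroupRep ((system W p κ).ρ b).toTopRep (κ.layerSubgroup b.1))
        (subgroupRep ((system W p κ).ρ a).toTopRep (κ.layerSubgroup b.1)) (red W p h) hcr
        (red_subgroupRep W p κ h (κ.layerSubgroup b.1))
        (mapH1AddHom (subgroupRep (W.torsionGaloisModule ((p : ℤ) ^ b.2)).toTopRep (κ.layerSubgroup b.1))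
          (subgroupRep ((system W p κ).ρ b).toTopRep (κ.layerSubgroup b.1))
          (AddMonoidHom.single (fun _ : ZMod (p ^ b.1) => geomTorsion W ((p : ℤ) ^ b.2)) 0) hcsb
          (single_subgroupRep W p κ b le_rfl 0) x) =
      mapH1AddHom (subgroupRep (W.torsionGaloisModule ((p : ℤ) ^ a.2)).toTopRep (κ.layerSubgroup b.1))
        (subgroupRep ((system W p κ).ρ a).toTopRep (κ.layerSubgroup b.1))
        (AddMonoidHom.single (fun _ : ZMod (p ^ a.1) => geomTorsion W ((p : ℤ) ^ a.2)) 0) hcsa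
        (single_subgroupRep W p κ a hba 0)
        (mapH1AddHom (subgroupRep (W.torsionGaloisModule ((p : ℤ) ^ b.2)).toTopRep (κ.layerSubgroup b.1))
          (subgroupRep (W.torsionGaloisModule ((p : ℤ) ^ a.2)).toTopRep (κ.layerSubgroup b.1))
          (torsionPowReduce W p h.2) hctp (torsionPowReduce_subgroupRep W p h.2 (κ.layerSubgroup b.1))
          x) := by
    rw [mapH1AddHom_mapH1AddHom (X := subgroupRep (W.torsionGaloisModule ((p : ℤ) ^ b.2)).toTopRep
        (κ.layerSubgroup b.1)) (Y := subgroupRep ((system W p κ).ρ b).toTopRep (κ.layerSubgroup b.1))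
        (Z := subgroupRep ((system W p κ).ρ a).toTopRep (κ.layerSubgroup b.1))
        (hgf := hcr.comp hcsb)
        (hgfρ := fun σ m => by rw [AddMonoidHom.comp_apply, AddMonoidHom.comp_apply,
          single_subgroupRep W p κ b le_rfl 0 σ m, red_subgroupRep W p κ h (κ.layerSubgroup b.1)]),
      mapH1AddHom_mapH1AddHom (X := subgroupRep (W.torsionGaloisModule ((p : ℤ) ^ b.2)).toTopRep
        (κ.layerSubgroup b.1)) (Y := subgroupRep (W.torsionGaloisModule ((p : ℤ) ^ a.2)).toTopRep
        (κ.layerSubgroup b.1)) (Z := subgroupRep ((system W p κ).ρ a).toTopRep (κ.layerSubgroup b.1))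
        (hgf := hcsa.comp hctp)
        (hgfρ := fun σ m => by rw [AddMonoidHom.comp_apply, AddMonoidHom.comp_apply,
          torsionPowReduce_subgroupRep W p h.2 (κ.layerSubgroup b.1) σ m, single_subgroupRep W p κ a hba])]
    exact mapH1AddHom_congr (X := subgroupRep (W.torsionGaloisModule ((p : ℤ) ^ b.2)).toTopRep
      (κ.layerSubgroup b.1)) (Y := subgroupRep ((system W p κ).ρ a).toTopRep (κ.layerSubgroup b.1))
      (red_comp_single_zero W p h) _ _ _ _ x
  rw [h2]
  -- (3) transitivity of `cor` and naturality in the coefficients again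
  have h3 := LinearMap.congr_fun (coresLe_comp ((system W p κ).ρ a).toTopRep hba ha0
    (κ.isOpen_layerSubgroup b.1) (κ.isOpen_layerSubgroup a.1))
    (mapH1AddHom (subgroupRep (W.torsionGaloisModule ((p : ℤ) ^ a.2)).toTopRep (κ.layerSubgroup b.1))
        (subgroupRep ((system W p κ).ρ a).toTopRep (κ.layerSubgroup b.1))
        (AddMonoidHom.single (fun _ : ZMod (p ^ a.1) => geomTorsion W ((p : ℤ) ^ a.2)) 0) hcsa
        (single_subgroupRep W p κ a hba 0)
        (mapH1AddHom (subgroupRep (W.torsionGaloisModule ((p : ℤ) ^ b.2)).toTopRep (κ.layerSubgroup b.1))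
          (subgroupRep (W.torsionGaloisModule ((p : ℤ) ^ a.2)).toTopRep (κ.layerSubgroup b.1))
          (torsionPowReduce W p h.2) hctp (torsionPowReduce_subgroupRep W p h.2 (κ.layerSubgroup b.1))
          x))
  rw [LinearMap.comp_apply] at h3
  refine h3.symm.trans ?_
  congr 1
  rw [← mapH1AddHom_coresLe (X := (W.torsionGaloisModule ((p : ℤ) ^ a.2)).toTopRep)
      (Y := ((system W p κ).ρ a).toTopRep) _ hcsa hba (κ.isOpen_layerSubgroup b.1)
      (single_subgroupRep W p κ a hba 0) (single_subgroupRep W p κ a le_rfl 0),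
    ← mapH1AddHom_coresLe (X := (W.torsionGaloisModule ((p : ℤ) ^ b.2)).toTopRep)
      (Y := (W.torsionGaloisModule ((p : ℤ) ^ a.2)).toTopRep) _ hctp hba (κ.isOpen_layerSubgroup b.1)
      (torsionPowReduce_subgroupRep W p h.2 (κ.layerSubgroup b.1))
      (torsionPowReduce_subgroupRep W p h.2 (κ.layerSubgroup a.1))]

/-! ## §7 Integrality: the inverse Shapiro image of an integral class dies on every inertia group -/

omit [W.IsElliptic] [ContinuousSMul ℤ_[p] (W.tateModule p)] in
/-- **An integral class goes to a class vanishing on the inertia groups `I_𝔓 ⊓ Γ_n`, `𝔓 ∤ p`**: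
for `x̄ ∈ H¹(ℤ_n[1/p], W[p^k])` (`integralH1`) and `𝔓` over `v ≠ p`,
`res_{Γ_n ⊓ I_𝔓} (cor_{Γ_n→Γ_0} (H¹(δ_0) x̄)) = 0` in `H¹(Γ_n ⊓ I_𝔓, W[p^k] ⊗ ℤ[Gal(ℚ_n/ℚ)])`:
`res ∘ cor = Σ_{g ∈ Γ_0/Γ_n} conj_g`, `conj_g ∘ H¹(δ_0) = H¹(δ_{κ̄ g}) ∘ conj_g`, and `conj_g x̄` is again
integral (`conjMap_mem_integralH1`), so its restriction to `I_{𝔓}` vanishes. [cite: Kato2004Asterisque, §8.2 and Lemma 8.5 (pp. 180–184), §13.8 (p. 228)] -/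
theorem resLe_coresLe_single_eq_zero_of_mem_integralH1 (a : ℕ × ℕ)
    [Fintype (κ.layerSubgroup 0 ⧸ (κ.layerSubgroup a.1).subgroupOf (κ.layerSubgroup 0))]
    (hcs : Continuous (AddMonoidHom.single (fun _ : ZMod (p ^ a.1) => geomTorsion W ((p : ℤ) ^ a.2)) 0))
    {v : IsDedekindDomain.HeightOneSpectrum (𝓞 ℚ)}
    (hv : ((Rat.HeightOneSpectrum.primesEquiv v : Nat.Primes) : ℕ) ≠ p)
    {𝔓 : Ideal (absIntegers (𝓞 ℚ) ℚ)} (h𝔓 : 𝔓 ∈ v.primesAbove)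
    {x : continuousCohomology 1
      (subgroupRep (W.torsionGaloisModule ((p : ℤ) ^ a.2)).toTopRep (κ.layerSubgroup a.1))}
    (hx : x ∈ integralH1 (W.torsionGaloisModule ((p : ℤ) ^ a.2)) p (κ.layerSubgroup a.1)) :
    resLe ((system W p κ).ρ a).toTopRep
        (show κ.layerSubgroup a.1 ⊓ 𝔓.inertia (absoluteGaloisGroup ℚ) ≤ κ.layerSubgroup a.1 from
          inf_le_left) 1
        (resLe ((system W p κ).ρ a).toTopRep (κ.layerSubgroup_antitone (Nat.zero_le a.1)) 1
          (coresLe ((system W p κ).ρ a).toTopRep (κ.layerSubgroup_antitone (Nat.zero_le a.1))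
            (κ.isOpen_layerSubgroup a.1)
            (mapH1AddHom (subgroupRep (W.torsionGaloisModule ((p : ℤ) ^ a.2)).toTopRep (κ.layerSubgroup a.1))
              (subgroupRep ((system W p κ).ρ a).toTopRep (κ.layerSubgroup a.1))
              (AddMonoidHom.single (fun _ : ZMod (p ^ a.1) => geomTorsion W ((p : ℤ) ^ a.2)) 0) hcs
              (single_subgroupRep W p κ a le_rfl 0) x))) = 0 := by
  classical
  have hs : ∀ y : κ.layerSubgroup 0 ⧸ (κ.layerSubgroup a.1).subgroupOf (κ.layerSubgroup 0),
      ((Quotient.out y : κ.layerSubgroup 0) :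
        κ.layerSubgroup 0 ⧸ (κ.layerSubgroup a.1).subgroupOf (κ.layerSubgroup 0)) = y :=
    fun y => QuotientGroup.out_eq' y
  rw [resLe_coresLe_eq_sum_conjMap ((system W p κ).ρ a).toTopRep (κ.layerSubgroup_antitone (Nat.zero_le a.1))
    (κ.isOpen_layerSubgroup a.1) hs, map_sum]
  refine Finset.sum_eq_zero fun y _ => ?_
  rw [conjMap_mapH1AddHom_single a ((Quotient.out y : κ.layerSubgroup 0) : absoluteGaloisGroup ℚ) 0 hcs
      continuous_of_discreteTopology,
    ← mapH1AddHom_resLe (X := (W.torsionGaloisModule ((p : ℤ) ^ a.2)).toTopRep)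
      (Y := ((system W p κ).ρ a).toTopRep) _ continuous_of_discreteTopology
      (show κ.layerSubgroup a.1 ⊓ 𝔓.inertia (absoluteGaloisGroup ℚ) ≤ κ.layerSubgroup a.1 from
        inf_le_left)
      (single_subgroupRep W p κ a inf_le_left _) (single_subgroupRep W p κ a le_rfl _)]
  have hint := IwasawaH1Exists.conjMap_mem_integralH1 (W.torsionGaloisModule ((p : ℤ) ^ a.2)) p (κ.layerSubgroup a.1)
    ((Quotient.out y : κ.layerSubgroup 0) : absoluteGaloisGroup ℚ) hx
  rw [mem_integralH1_iff] at hint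
  rw [hint v hv 𝔓 h𝔓, map_zero]

/-! ## §8 Bridging lemmas for the inverse-limit comparison `H¹(Γ_0, 𝕋) ≅ lim H¹(Γ_0, P_a)` -/

omit [ContinuousSMul ℤ_[p] (W.tateModule p)] in
/-- `torsionPowReduce` (`[p^{k'−k}] : W[p^{k'}] → W[p^k]`) is surjective — `E(ℚ̄)` is divisible.
[cite: SilvermanAEC2009, III.§7] -/
theorem torsionPowReduce_surjective {k k' : ℕ} (h : k ≤ k') :
    Function.Surjective (torsionPowReduce W p h) := by
  have hp : p.Prime := Fact.out
  intro Q
  obtain ⟨P, hP⟩ := W.zsmul_geomPoints_surjective_holds (n := (p : ℤ) ^ (k' - k))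
    (pow_ne_zero _ (by exact_mod_cast hp.ne_zero)) (Q : geomPoints W)
  have hQ : ((p : ℤ) ^ k) • (Q : geomPoints W) = 0 := (Submodule.mem_torsionBy_iff _ _).1 Q.2
  refine ⟨⟨P, (Submodule.mem_torsionBy_iff _ _).2 ?_⟩, Subtype.ext ?_⟩
  · have hP' : ((p : ℤ) ^ (k' - k)) • P = Q := hP
    change ((p : ℤ) ^ k') • P = 0
    rw [← Nat.sub_add_cancel h, pow_add, mul_comm, mul_smul, hP', hQ]
  · rw [coe_torsionPowReduce]; exact hP

omit [ContinuousSMul ℤ_[p] (W.tateModule p)] in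
/-- The transition maps `red` of the coefficient system are surjective (hypothesis of
`DiscreteInvSystem.toCohomologyLimit₁_surjective`). [cite: Kato2004Asterisque, §13.8 (p. 228)] -/
theorem red_surjective {a b : ℕ × ℕ} (h : a ≤ b) : Function.Surjective (red W p h) := by
  classical
  intro z
  choose m hm using fun c => torsionPowReduce_surjective W p h.2 (z c)
  choose l hl using castLE_surjective (p := p) h.1
  refine ⟨∑ c, Pi.single (l c) (m c), funext fun c => ?_⟩
  rw [map_sum, Finset.sum_apply, Finset.sum_eq_single c]
  · rw [red_apply, fiberSum_single h.1, hl, Pi.single_eq_same, hm]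
  · intro c' _ hc'
    rw [red_apply, fiberSum_single h.1, hl, Pi.single_eq_of_ne (Ne.symm hc'), map_zero]
  · intro hc; exact absurd (Finset.mem_univ c) hc

omit [ContinuousSMul ℤ_[p] (W.tateModule p)] in
/-- The coefficient groups `ℤ/p^n → W[p^k]` are finite (hypothesis of
`DiscreteInvSystem.toCohomologyLimit₁_injective`). [cite: SilvermanAEC2009, III.§7] -/
theorem finite_coeff (a : ℕ × ℕ) : Finite (Coeff W p a) := by
  have hp : p.Prime := Fact.out
  haveI : Finite (geomTorsion W ((p : ℤ) ^ a.2)) :=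
    WeierstrassCurve.finite_torsionPoints_holds W (AlgebraicClosure ℚ)
      (pow_ne_zero _ (by exact_mod_cast hp.ne_zero))
  unfold Coeff; infer_instance

omit [W.IsElliptic] [ContinuousSMul ℤ_[p] (W.tateModule p)] in
/-- `H¹` of the transition morphism `redHom h` of `systemOn H` IS `mapH1AddHom` along `red h` between the
restricted representations (bridge from the categorical `cohomologyMap` of
`DiscreteInvSystem.cohomologyLimit` to the tree's `mapH1AddHom` calculus). [cite: Kato2004Asterisque, §13.8 (p. 228)] -/
theorem cohomologyMap_systemOn_redHom (H : Subgroup (absoluteGaloisGroup ℚ)) {a b : ℕ × ℕ} (h : a ≤ b)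
    (hcr : Continuous (red W p h))
    (c : continuousCohomology 1 (subgroupRep ((system W p κ).ρ b).toTopRep H)) :
    cohomologyMap ((systemOn W p κ H).redHom h) 1 c =
      mapH1AddHom (subgroupRep ((system W p κ).ρ b).toTopRep H)
        (subgroupRep ((system W p κ).ρ a).toTopRep H) (red W p h) hcr (red_subgroupRep W p κ h H) c :=
  cohomologyMap_one_eq_mapH1AddHom (A := subgroupRep ((system W p κ).ρ b).toTopRep H)
    (B := subgroupRep ((system W p κ).ρ a).toTopRep H) ((systemOn W p κ H).redHom h) hcr
    (fun σ y => red_subgroupRep W p κ h H σ y) c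

omit [W.IsElliptic] [ContinuousSMul ℤ_[p] (W.tateModule p)] in
/-- `H¹` of the projection morphism `projHom a` of `systemOn H` IS `mapH1AddHom` along `projAddHom a`.
[cite: Kato2004Asterisque, §13.8 (p. 228)] -/
theorem cohomologyMap_systemOn_projHom (H : Subgroup (absoluteGaloisGroup ℚ)) (a : ℕ × ℕ)
    (hcp : Continuous ((system W p κ).projAddHom a))
    (c : continuousCohomology 1 (subgroupRep (system W p κ).limitRep.toTopRep H)) :
    cohomologyMap ((systemOn W p κ H).projHom a) 1 c =
      mapH1AddHom (subgroupRep (system W p κ).limitRep.toTopRep H)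
        (subgroupRep ((system W p κ).ρ a).toTopRep H) ((system W p κ).projAddHom a) hcp
        (projAddHom_subgroupRep W p κ a H) c :=
  cohomologyMap_one_eq_mapH1AddHom (A := subgroupRep (system W p κ).limitRep.toTopRep H)
    (B := subgroupRep ((system W p κ).ρ a).toTopRep H) ((systemOn W p κ H).projHom a) hcp
    (fun σ μ => projAddHom_subgroupRep W p κ a H σ μ) c

omit [W.IsElliptic] [ContinuousSMul ℤ_[p] (W.tateModule p)] in
/-- `H¹(red h) ∘ H¹(pr_b) = H¹(pr_a)` on `H¹(H, 𝕋)`. [cite: Kato2004Asterisque, §13.8 (p. 228)] -/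
theorem mapH1AddHom_red_projAddHom (H : Subgroup (absoluteGaloisGroup ℚ)) {a b : ℕ × ℕ} (h : a ≤ b)
    (hcr : Continuous (red W p h)) (hcpa : Continuous ((system W p κ).projAddHom a))
    (hcpb : Continuous ((system W p κ).projAddHom b))
    (c : continuousCohomology 1 (subgroupRep (system W p κ).limitRep.toTopRep H)) :
    mapH1AddHom (subgroupRep ((system W p κ).ρ b).toTopRep H)
        (subgroupRep ((system W p κ).ρ a).toTopRep H) (red W p h) hcr (red_subgroupRep W p κ h H)
        (mapH1AddHom (subgroupRep (system W p κ).limitRep.toTopRep H)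
          (subgroupRep ((system W p κ).ρ b).toTopRep H) ((system W p κ).projAddHom b) hcpb
          (projAddHom_subgroupRep W p κ b H) c) =
      mapH1AddHom (subgroupRep (system W p κ).limitRep.toTopRep H)
        (subgroupRep ((system W p κ).ρ a).toTopRep H) ((system W p κ).projAddHom a) hcpa
        (projAddHom_subgroupRep W p κ a H) c := by
  have hfg : (red W p h).comp ((system W p κ).projAddHom b) = (system W p κ).projAddHom a :=
    AddMonoidHom.ext fun μ => (system W p κ).red_apply_coe μ h
  rw [mapH1AddHom_mapH1AddHom (X := subgroupRep (system W p κ).limitRep.toTopRep H)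
      (Y := subgroupRep ((system W p κ).ρ b).toTopRep H) (Z := subgroupRep ((system W p κ).ρ a).toTopRep H)
      (hgf := by rw [hfg]; exact hcpa)
      (hgfρ := fun σ μ => by rw [hfg]; exact projAddHom_subgroupRep W p κ a H σ μ)]
  exact mapH1AddHom_congr (X := subgroupRep (system W p κ).limitRep.toTopRep H)
    (Y := subgroupRep ((system W p κ).ρ a).toTopRep H) hfg _ _ _ _ c

omit [W.IsElliptic] [Fact (Nat.Prime p)] [ContinuousSMul ℤ_[p] (W.tateModule p)] in
/-- `[p^{k'−k}] ∘ (mod p^{k'}) = (mod p^k)` on `T_pW`. [cite: SilvermanAEC2009, III.§7] -/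
theorem torsionPowReduce_comp_tateModPk {k k' : ℕ} (h : k ≤ k') :
    (torsionPowReduce W p h).comp (tateModPk W p k') = tateModPk W p k := by
  refine AddMonoidHom.ext fun a => Subtype.ext ?_
  rw [AddMonoidHom.comp_apply, coe_torsionPowReduce, coe_tateModPk_apply, coe_tateModPk_apply]
  have := pow_smul_proj_add W p a k (k' - k)
  rwa [Nat.add_sub_cancel' h] at this

/-- **`H¹([p^{k'−k}]) ∘ red_{p^{k'}} = red_{p^k}`** on `H¹(U, T_pW)`. [cite: Kato2004Asterisque, §13.8 (p. 228)] -/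
theorem mapH1AddHom_torsionPowReduce_reduceH1Pk {k k' : ℕ} (h : k ≤ k')
    (U : Subgroup (absoluteGaloisGroup ℚ)) (hct : Continuous (torsionPowReduce W p h))
    (c : H1 (tateRep W p) U) :
    mapH1AddHom (subgroupRep (W.torsionGaloisModule ((p : ℤ) ^ k')).toTopRep U)
        (subgroupRep (W.torsionGaloisModule ((p : ℤ) ^ k)).toTopRep U) (torsionPowReduce W p h) hct
        (torsionPowReduce_subgroupRep W p h U) (reduceH1Pk W p k' U c) = reduceH1Pk W p k U c := by
  unfold reduceH1Pk
  rw [mapH1AddHom_mapH1AddHom (X := subgroupRep (tateRep W p).toTopRep U)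
      (Y := subgroupRep (W.torsionGaloisModule ((p : ℤ) ^ k')).toTopRep U)
      (Z := subgroupRep (W.torsionGaloisModule ((p : ℤ) ^ k)).toTopRep U)
      (hgf := by rw [torsionPowReduce_comp_tateModPk]; exact continuous_tateModPk W p k)
      (hgfρ := fun σ a => by rw [torsionPowReduce_comp_tateModPk]; exact tateModPk_subgroupRep W p k U σ a)]
  exact mapH1AddHom_congr (X := subgroupRep (tateRep W p).toTopRep U)
    (Y := subgroupRep (W.torsionGaloisModule ((p : ℤ) ^ k)).toTopRep U)
    (torsionPowReduce_comp_tateModPk W p h) _ _ _ _ c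

end TwistTate

end Literature.NumberTheory.EllipticCurves.Kato2004

end
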